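import Summits.KontsevichZagierPeriods.KontsevichZagierPeriods.Theses.VietaFibre
import Summits.KontsevichZagierPeriods.KontsevichZagierPeriods.Theses.Neg
import Summits.KontsevichZagierPeriods.KontsevichZagierPeriods.Theses.OctahedralSymmetry
import Summits.KontsevichZagierPeriods.KontsevichZagierPeriods.Theorems.VietaFibreKernelFormCancellerNormalForm
import Summits.KontsevichZagierPeriods.KontsevichZagierPeriods.Theorems.VietaFibreKernelFormCancellationDictionary
import HarnessLib

/-!
# Crux `KernelForm` (stmt-KontsevichZagierPeriods-10447), line `Sketch`: the cut
# `KernelForm ↔ WeakKernel ∧ Cancellation ↔ WeakKernel ∧ ThinCancellation`, and the dictionary closed up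

`KernelForm` (kernel form of Kontsevich–Zagier's Conjecture 1 for the calculus of `KZCalculus.lean`;
item stmt-KontsevichZagierPeriods-10447 of routes VietaFibre / OctahedralSymmetry) is cut along the
value prime `𝔭 = ker eval` of the formal period ring `P = KZ.FormalRep ⧸ KZ.relations`:

* `kernelForm_iff` — `KernelForm ↔ WeakKernel ∧ Cancellation` with
  `WeakKernel := ∀ c, eval c = 0 → ∃ s, eval s ≠ 0 ∧ s * c ∈ relations` (transcendence half, of the
  strength of Conjecture 1) and `Cancellation := ∀ c s, eval s ≠ 0 → s * c ∈ relations → c ∈ relations`;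
* `cancellation_iff_thinCancellation` — by the canceller normal form, `Cancellation` is equivalent to
  its thin case (cancellers `1 + [K, κ]`, `K` compact with non-empty interior, `κ ∈ ℚ_{>0}`, value `< ε`);
* `kernelForm_iff_weakKernel_and_thinCancellation` — the line's composition in closed form: the crux
  is equivalent to the conjunction of its two conjecture-grade stubs;
* `cancellationGap_of_not_cancellation`, `cancellationGap_iff_not_cancellation` — route Neg's crux
  `CancellationGap` (stmt-11011) is exactly `¬ Cancellation`;
* `cancellation_iff_positiveCancellation`, `thinCancellation_iff_positiveCancellation` — route
  SelbergAMGM's crux `PositiveCancellation` (stmt-5621) is the same statement again;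
* `octahedralSymmetry_kernelForm_iff_weakKernel_and_thinCancellation` — the same cut for route
  OctahedralSymmetry's (definitionally equal) name of the crux.

All statements inline over the calculus (no new definitions); nothing conjecture-grade is claimed.

References: M. Kontsevich, D. Zagier, *Periods* (2001), §1.2, §4.1; A. Huber, G. Wüstholz,
*Transcendence and linear relations of 1-periods* (2022), App. A.3–A.4 (the motivic shadow of
Cancellation is open in print).
-/

noncomputable section

open MeasureTheory Set
open Literature.NumberTheory.Transcendental

namespace Summit.KontsevichZagierPeriods.KernelForm.LocaliseAtValuePrime

/-! ### The cut along the value prime -/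

/-- **The cut `KernelForm ↔ WeakKernel ∧ Cancellation`.** `→`: `[π]` (value `π ≠ 0`) multiplies
relations into relations (left ideal), and `eval` is multiplicative and sound; `←`: compose.
(The route decl used is `VietaFibre.KernelForm`; `OctahedralSymmetry.KernelForm` is the same term.)
[folklore] -/
theorem kernelForm_iff :
    Summit.KontsevichZagierPeriods.KontsevichZagierPeriods.Theses.VietaFibre.KernelForm ↔
      (∀ c : KZ.FormalRep, KZ.eval c = 0 → ∃ s : KZ.FormalRep, KZ.eval s ≠ 0 ∧ s * c ∈ KZ.relations) ∧
      (∀ c s : KZ.FormalRep, KZ.eval s ≠ 0 → s * c ∈ KZ.relations → c ∈ KZ.relations) := by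
  unfold Summit.KontsevichZagierPeriods.KontsevichZagierPeriods.Theses.VietaFibre.KernelForm
  constructor
  · intro hK
    refine ⟨fun c hc => ⟨KZ.of KZ.piRep, ?_, ?_⟩, fun c s hs hsc => hK c ?_⟩
    · rw [KZ.eval_of_piRep]; exact Real.pi_ne_zero
    · exact KZ.mul_mem_relations_left_holds _ _ (hK c hc)
    · have h := KZ.relations_le_ker_eval_holds hsc
      rw [AddMonoidHom.mem_ker, KZ.eval_mul'] at h
      rcases mul_eq_zero.mp h with h | h
      · exact absurd h hs
      · exact h
  · rintro ⟨hW, hC⟩ c hc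
    obtain ⟨s, hs, hsc⟩ := hW c hc
    exact hC c s hs hsc

/-- **`Cancellation` is equivalent to its thin case.** `→`: the thin datum at `ε = 1` gives a
canceller `[U] + [K, κ]` (`U` the unit cube, `[U] * c ≡ c` by `stub_cubeMul`) of value
`1 + eval [K, κ] > 0`; `←`: the canceller normal form. [folklore] -/
theorem cancellation_iff_thinCancellation :
    (∀ c s : KZ.FormalRep, KZ.eval s ≠ 0 → s * c ∈ KZ.relations → c ∈ KZ.relations) ↔
      (∀ c : KZ.FormalRep,
        (∀ ε : ℝ, 0 < ε → ∃ (k : ℕ) (K : KZ.IntegralRep (k + 1)) (κ : ℚ), 0 < κ ∧ IsCompact K.domain ∧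
          (interior K.domain).Nonempty ∧ (∀ x ∈ K.domain, K.integrand x = κ) ∧
          KZ.eval (KZ.of K) < ε ∧ c + KZ.of K * c ∈ KZ.relations) →
        c ∈ KZ.relations) := by
  constructor
  · intro hC c hthin
    obtain ⟨k, K, κ, hκ, -, -, hKi, -, hcK⟩ := hthin 1 one_pos
    obtain ⟨U, hUd, hUi⟩ := KZ.exists_oneRep (KZ.isSemialgebraic_cube (n := k + 1))
      (by simp [KZ.volume_cube])
    have hUv : U.value = 1 := by
      rw [KZ.IntegralRep.value_eq_volume_real U (fun x _ => by rw [hUi]), hUd, KZ.volume_real_cube]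
    refine hC c (KZ.of U + KZ.of K) ?_ ?_
    · rw [map_add, KZ.eval_of, KZ.eval_of, hUv]
      have := value_nonneg_of_integrand_eq_const K hκ hKi
      linarith
    · have hU1 : KZ.of U * c - c ∈ KZ.relations := by
        have e : KZ.of U * c - c = (KZ.of U * c - c * KZ.of U) + (c * KZ.of U - c) := by abel
        rw [e]
        exact KZ.relations.add_mem (KZ.mul_sub_mul_comm_mem_relations _ _)
          (stub_cubeMul (k + 1) U c hUd hUi)
      have e : (KZ.of U + KZ.of K) * c = (KZ.of U * c - c) + (c + KZ.of K * c) := by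
        rw [add_mul]; abel
      rw [e]
      exact KZ.relations.add_mem hU1 hcK
  · intro hT c s hs hsc
    exact hT c (fun ε hε => cancellerNormalForm c s hs hsc ε hε)

/-- **The line's composition in closed form**: `KernelForm ↔ WeakKernel ∧ ThinCancellation` — the
crux is equivalent to the conjunction of its two conjecture-grade stubs (the weak kernel, and
cancellation by `1 + [K, κ]` for thin compact volume forms); nothing is lost by the cut. [folklore] -/
theorem kernelForm_iff_weakKernel_and_thinCancellation :
    Summit.KontsevichZagierPeriods.KontsevichZagierPeriods.Theses.VietaFibre.KernelForm ↔ (∀ c : KZ.FormalRep, KZ.eval c = 0 → ∃ s : KZ.FormalRep, KZ.eval s ≠ 0 ∧ s * c ∈ KZ.relations) ∧ (∀ c : KZ.FormalRep, (∀ ε : ℝ, 0 < ε → ∃ (k : ℕ) (K : KZ.IntegralRep (k + 1)) (κ : ℚ), 0 < κ ∧ IsCompact K.domain ∧ (interior K.domain).Nonempty ∧ (∀ x ∈ K.domain, K.integrand x = κ) ∧ KZ.eval (KZ.of K) < ε ∧ c + KZ.of K * c ∈ KZ.relations) → c ∈ KZ.relations) := by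
  rw [kernelForm_iff, cancellation_iff_thinCancellation]

/-! ### `¬ Cancellation` is route Neg's `CancellationGap` -/

/-- A single-representation zero-divisor datum is a `CancellationGap` (stmt-11011): if `[K]` has
non-zero value, `[K] * ([r] − [r']) ∈ relations` and `r ≁ r'`, then the Fubini products `r.prod K`,
`r'.prod K` witness the gap (their domains and integrands have literally the required shape).
[folklore] -/
theorem cancellationGap_of_single {n m j : ℕ} (r : KZ.IntegralRep n) (r' : KZ.IntegralRep m)
    (K : KZ.IntegralRep j) (hK : K.value ≠ 0)
    (hmul : KZ.of K * (KZ.of r - KZ.of r') ∈ KZ.relations) (hne : ¬ KZ.Equivalent r r') :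
    Summit.KontsevichZagierPeriods.KontsevichZagierPeriods.Theses.Neg.CancellationGap := by
  refine ⟨n, m, j, r, r', K, r.prod K, r'.prod K, rfl, fun z _ => ?_, rfl, fun z _ => ?_, hK, ?_, hne⟩
  · rw [KZ.IntegralRep.prod_integrand_eq, KZ.IntegralRep.prodFun_apply]
  · rw [KZ.IntegralRep.prod_integrand_eq, KZ.IntegralRep.prodFun_apply]
  · unfold KZ.Equivalent
    rw [← KZ.of_mul_of, ← KZ.of_mul_of, ← sub_mul]
    exact KZ.mul_mem_relations_of_left hmul

/-- **`¬ Cancellation → CancellationGap`**: a zero-divisor datum `s * c ∈ relations`, `eval s ≠ 0`,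
`c ∉ relations` is normalised to route Neg's format — `c ≡ [r] − [r']`
(`KZ.exists_integralRep_sub_holds`) and `s ≡ ±[K]` with `K` ONE compact volume form (bounded
decomposition `stub_boundedDecomposition` + Viu-Sos packing according to the sign of `eval s`).
Together with `not_cancellation_of_cancellationGap` (file `…CancellationDictionary.lean`):
`CancellationGap ↔ ¬ Cancellation`. [folklore] -/
theorem cancellationGap_of_not_cancellation
    (h : ¬ ∀ c s : KZ.FormalRep, KZ.eval s ≠ 0 → s * c ∈ KZ.relations → c ∈ KZ.relations) :
    Summit.KontsevichZagierPeriods.KontsevichZagierPeriods.Theses.Neg.CancellationGap := by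
  push Not at h
  obtain ⟨c, s, hs, hsc, hc⟩ := h
  obtain ⟨n, m, r, r', hcr⟩ := KZ.exists_integralRep_sub_holds c
  have hne : ¬ KZ.Equivalent r r' := by
    intro hrr'
    apply hc
    have : c = (c - (KZ.of r - KZ.of r')) + (KZ.of r - KZ.of r') := by abel
    rw [this]
    exact KZ.relations.add_mem hcr hrr'
  -- `s * ([r] − [r']) ∈ relations`
  have hsr : s * (KZ.of r - KZ.of r') ∈ KZ.relations := by
    have h1 := KZ.mul_mem_relations_left_holds _ s hcr
    rw [mul_sub] at h1
    have : s * (KZ.of r - KZ.of r') = s * c - (s * c - s * (KZ.of r - KZ.of r')) := by abel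
    rw [this]
    exact KZ.relations.sub_mem hsc h1
  -- `s ≡ [A] − [B]`, bounded volume forms
  obtain ⟨k, A, B, hAb, hBb, hA1, hB1, hsAB⟩ := stub_boundedDecomposition s
  have hvAB : KZ.eval s = A.value - B.value := by
    have h := eval_eq_zero_of_mem hsAB
    simp only [map_sub, KZ.eval_of] at h
    linarith
  have hABr : (KZ.of A - KZ.of B) * (KZ.of r - KZ.of r') ∈ KZ.relations := by
    have h1 := KZ.mul_mem_relations_right_holds _ (KZ.of r - KZ.of r') hsAB
    rw [sub_mul] at h1
    have : (KZ.of A - KZ.of B) * (KZ.of r - KZ.of r') = s * (KZ.of r - KZ.of r') -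
        (s * (KZ.of r - KZ.of r') - (KZ.of A - KZ.of B) * (KZ.of r - KZ.of r')) := by abel
    rw [this]
    exact KZ.relations.sub_mem hsr h1
  rcases lt_or_gt_of_ne hs with hneg | hpos
  · -- `eval s < 0`: pack `[B] − [A] ≡ [K]`
    obtain ⟨K, -, -, hK1, hBAK⟩ :=
      KZ.exists_isCompact_of_sub_of_sub_mem_relations B A hBb hAb hB1 hA1 (by linarith)
    have hKv : K.value = B.value - A.value := by
      have h := eval_eq_zero_of_mem hBAK
      simp only [map_sub, KZ.eval_of] at h
      linarith
    refine cancellationGap_of_single r r' K (by rw [hKv]; linarith) ?_ hne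
    have h1 := KZ.mul_mem_relations_right_holds _ (KZ.of r - KZ.of r') hBAK
    rw [sub_mul, sub_mul] at h1
    have : KZ.of K * (KZ.of r - KZ.of r') = -((KZ.of A - KZ.of B) * (KZ.of r - KZ.of r')) -
        (KZ.of B * (KZ.of r - KZ.of r') - KZ.of A * (KZ.of r - KZ.of r') - KZ.of K * (KZ.of r - KZ.of r')) := by
      rw [sub_mul]; abel
    rw [this]
    exact KZ.relations.sub_mem (KZ.relations.neg_mem hABr) h1
  · -- `0 < eval s`: pack `[A] − [B] ≡ [K]`
    obtain ⟨K, -, -, hK1, hABK⟩ :=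
      KZ.exists_isCompact_of_sub_of_sub_mem_relations A B hAb hBb hA1 hB1 (by linarith)
    have hKv : K.value = A.value - B.value := by
      have h := eval_eq_zero_of_mem hABK
      simp only [map_sub, KZ.eval_of] at h
      linarith
    refine cancellationGap_of_single r r' K (by rw [hKv]; linarith) ?_ hne
    have h1 := KZ.mul_mem_relations_right_holds _ (KZ.of r - KZ.of r') hABK
    rw [sub_mul, sub_mul] at h1
    have : KZ.of K * (KZ.of r - KZ.of r') = (KZ.of A - KZ.of B) * (KZ.of r - KZ.of r') -
        (KZ.of A * (KZ.of r - KZ.of r') - KZ.of B * (KZ.of r - KZ.of r') - KZ.of K * (KZ.of r - KZ.of r')) := by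
      rw [sub_mul]; abel
    rw [this]
    exact KZ.relations.sub_mem hABr h1

/-! ### The dictionary closed up -/

/-- **`CancellationGap ↔ ¬ Cancellation`** (route Neg's crux stmt-11011 is exactly the negation of
the geometric half). [folklore] -/
theorem cancellationGap_iff_not_cancellation :
    Summit.KontsevichZagierPeriods.KontsevichZagierPeriods.Theses.Neg.CancellationGap ↔
      ¬ ∀ c s : KZ.FormalRep, KZ.eval s ≠ 0 → s * c ∈ KZ.relations → c ∈ KZ.relations :=
  ⟨not_cancellation_of_cancellationGap, cancellationGap_of_not_cancellation⟩

/-- **`Cancellation ↔ PositiveCancellation`** (route SelbergAMGM's crux stmt-5621 is the geometric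
half again): `→` in the formal period ring; `←` through thin cancellation and the normal form.
[folklore] -/
theorem cancellation_iff_positiveCancellation :
    (∀ c s : KZ.FormalRep, KZ.eval s ≠ 0 → s * c ∈ KZ.relations → c ∈ KZ.relations) ↔
      Summit.KontsevichZagierPeriods.KontsevichZagierPeriods.Theses.SelbergAMGM.PositiveCancellation :=
  ⟨positiveCancellation_of_cancellation, fun h =>
    cancellation_iff_thinCancellation.mpr (thinCancellation_of_positiveCancellation h)⟩

/-- **`ThinCancellation ↔ PositiveCancellation`**: the line's conjecture-grade stub
`stub_unitPlusSmallCancellation` is literally equivalent to stmt-5621. [folklore] -/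
theorem thinCancellation_iff_positiveCancellation :
    (∀ c : KZ.FormalRep,
        (∀ ε : ℝ, 0 < ε → ∃ (k : ℕ) (K : KZ.IntegralRep (k + 1)) (κ : ℚ), 0 < κ ∧ IsCompact K.domain ∧
          (interior K.domain).Nonempty ∧ (∀ x ∈ K.domain, K.integrand x = κ) ∧
          KZ.eval (KZ.of K) < ε ∧ c + KZ.of K * c ∈ KZ.relations) →
        c ∈ KZ.relations) ↔
      Summit.KontsevichZagierPeriods.KontsevichZagierPeriods.Theses.SelbergAMGM.PositiveCancellation := by
  rw [← cancellation_iff_thinCancellation, cancellation_iff_positiveCancellation]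

/-! ### The twin decl of route OctahedralSymmetry -/

/-- `OctahedralSymmetry.KernelForm` and `VietaFibre.KernelForm` are the same term (the shared item
stmt-KontsevichZagierPeriods-10447). [folklore] -/
theorem octahedralSymmetry_kernelForm_iff_vietaFibre_kernelForm :
    Summit.KontsevichZagierPeriods.KontsevichZagierPeriods.Theses.OctahedralSymmetry.KernelForm ↔
      Summit.KontsevichZagierPeriods.KontsevichZagierPeriods.Theses.VietaFibre.KernelForm :=
  Iff.rfl

/-- The cut `KernelForm ↔ WeakKernel ∧ ThinCancellation` for route OctahedralSymmetry's name of the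
crux. [folklore] -/
theorem octahedralSymmetry_kernelForm_iff_weakKernel_and_thinCancellation :
    Summit.KontsevichZagierPeriods.KontsevichZagierPeriods.Theses.OctahedralSymmetry.KernelForm ↔
      (∀ c : KZ.FormalRep, KZ.eval c = 0 → ∃ s : KZ.FormalRep, KZ.eval s ≠ 0 ∧ s * c ∈ KZ.relations) ∧
      (∀ c : KZ.FormalRep,
        (∀ ε : ℝ, 0 < ε → ∃ (k : ℕ) (K : KZ.IntegralRep (k + 1)) (κ : ℚ), 0 < κ ∧ IsCompact K.domain ∧
          (interior K.domain).Nonempty ∧ (∀ x ∈ K.domain, K.integrand x = κ) ∧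
          KZ.eval (KZ.of K) < ε ∧ c + KZ.of K * c ∈ KZ.relations) →
        c ∈ KZ.relations) :=
  kernelForm_iff_weakKernel_and_thinCancellation

end Summit.KontsevichZagierPeriods.KernelForm.LocaliseAtValuePrime
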